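import Literature.NumberTheory.Rogawski1990.KottwitzSignUnipotentCriterion
import Literature.NumberTheory.Rogawski1990.KottwitzSignReadings
import Literature.NumberTheory.Automorphic.UnitaryGroupNonsplitPlace
import Literature.NumberTheory.Automorphic.LocalRegularOrbitClosed
import Literature.NumberTheory.Automorphic.Liu2021.LemD1DataOfPlace
import HarnessLib

/-!
# The local Kottwitz signs `e_v` are preserved by the kit's local identifications `ψ_v : U(H)(L⁺_v) ≅ U(H′)(L⁺_v)`
# whenever `ψ_v` is a matrix conjugation (Rogawski 1990, §4.1 (4.1.2); §14.2 p. 232 «we fix an inner isomorphism `ψ : G′ → G`»)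

Topic `NumberTheory/Rogawski1990`; namespace `Literature.NumberTheory.Rogawski1990`. THEOREMS ONLY over accepted tree modules: no
definition, no named fact, no instance, no notation, no `sorry`. Cell `pub/hodgecm-mathlib`, ENGINE T1 (crux H413 =
`stmt-HodgeConjecture-24833`), O7 row (ψ-e) part (c) of A-p01's OWNER WORD #26 (2): the CM READING of the unipotent criterion ★
`KottwitzSignUnipotentCriterion` for the local class functions ★ `kottwitzSignLocal` of ★ `KottwitzSignCM`.

For a CM field `L`, hermitian non-degenerate `H, H′ ∈ M₃(L)`, a finite place `v` of `L⁺` and a map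
`ψ : U(H)(L⁺_v) → U(H′)(L⁺_v)` which is SURJECTIVE and a MATRIX CONJUGATION `ψ g = S⁻¹ g S` (`S ∈ GL₃(L ⊗ L⁺_v)`) — the shape of the
engine's family pin (vii-c) «`ψ_v` is matrix conjugation» (★ `UnitaryGroup.exists_psi_conj_forall_levelMatching`) — we prove

  **`kottwitzSignLocal L 3 H′ v ⟦ψ x⟧ = kottwitzSignLocal L 3 H v ⟦x⟧`** (`kottwitzSignLocal_mk_eq_of_forall_coe_eq_conj`).

At a SPLIT `v` both sides are `1` (★ `kottwitzSignLocal_eq_one_of_smul_ne`). At a NON-SPLIT `v` the local ring `L ⊗ L⁺_v = ∏_{w∣v} L_w`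
is a field IN PLACE (★ `UnitaryGroup.LocalRing.isField_of_smul_eq`), its involution `c ⊗ 1` is non-trivial, the local Gram matrices are
hermitian and non-degenerate (★ `map_conjLocal_transpose_localForm`, ★ `isUnit_det_localForm`), and the conjugation invariance ★
`kottwitzSign_conj_eq_of_forall_mem_iff` of the unipotent criterion applies.

## References
* [Rogawski1990] J. D. Rogawski, *Automorphic Representations of Unitary Groups in Three Variables*, Ann. of Math. Stud. 123 (1990),
  §4.1 (4.1.2) pp. 39–40; §8.2 p. 117; §14.2 p. 232.
* [Kottwitz1983] R. E. Kottwitz, *Sign changes in harmonic analysis on reductive groups*, Trans. AMS 278 (1983), 289–297.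
-/

set_option autoImplicit false

noncomputable section

open NumberField IsDedekindDomain Matrix
open scoped MatrixGroups

namespace Literature.NumberTheory.Rogawski1990

open Literature.NumberTheory.Automorphic
open Literature.AlgebraicGeometry.ShimuraVarieties (unitaryGroup)

section CM

variable (L : Type) [Field L] [NumberField L] [IsCMField L]

/-- At every finite place `v` of `L⁺` the involution `c ⊗ 1` of `L ⊗ L⁺_v` is NON-TRIVIAL: `(c ⊗ 1)(e ⊗ 1) = c(e) ⊗ 1 ≠ e ⊗ 1`
for any `e ∈ L` moved by `c` (`L → L_w` is injective). [cite: Rogawski1990, §1.9 p. 8] -/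
theorem exists_conjLocal_ne (v : HeightOneSpectrum (𝓞 ↥(maximalRealSubfield L))) :
    ∃ x : UnitaryGroup.LocalRing L v, UnitaryGroup.conjLocal L (IsCMField.complexConj L) v x ≠ x := by
  obtain ⟨e, he⟩ : ∃ e : L, IsCMField.complexConj L e ≠ e := by
    by_contra h
    exact IsCMField.complexConj_ne_one L (AlgEquiv.ext fun x => not_ne_iff.mp (not_exists.mp h x))
  refine ⟨algebraMap L (UnitaryGroup.LocalRing L v) e, ?_⟩
  rw [UnitaryGroup.conjLocal_algebraMap]
  intro h
  obtain ⟨w⟩ := (inferInstance : Nonempty (UnitaryGroup.PlacesOver L v))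
  have hw := congrFun h w
  rw [Pi.algebraMap_apply, Pi.algebraMap_apply] at hw
  exact he ((algebraMap L (w.1.adicCompletion L)).injective hw)

/-- `c ⊗ 1` is an involution of `L ⊗ L⁺_v` (★ `Liu2021.LemD1OfPlace.conjLocal_conjLocal_apply` with `δ = e − c e`).
[cite: Rogawski1990, §1.9 p. 8] -/
theorem conjLocal_conjLocal (v : HeightOneSpectrum (𝓞 ↥(maximalRealSubfield L))) (x : UnitaryGroup.LocalRing L v) :
    UnitaryGroup.conjLocal L (IsCMField.complexConj L) v (UnitaryGroup.conjLocal L (IsCMField.complexConj L) v x) = x := by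
  haveI : Algebra.IsQuadraticExtension ↥(maximalRealSubfield L) L := IsCMField.isQuadraticExtension L
  obtain ⟨e, he⟩ : ∃ e : L, IsCMField.complexConj L e ≠ e := by
    by_contra h
    exact IsCMField.complexConj_ne_one L (AlgEquiv.ext fun x => not_ne_iff.mp (not_exists.mp h x))
  have hcδ : IsCMField.complexConj L (e - IsCMField.complexConj L e) = -(e - IsCMField.complexConj L e) := by
    rw [map_sub, IsCMField.complexConj_apply_apply, neg_sub]
  have hδ : e - IsCMField.complexConj L e ≠ 0 := sub_ne_zero.2 (Ne.symm he)
  exact Liu2021.LemD1OfPlace.conjLocal_conjLocal_apply L v (IsCMField.complexConj L) hcδ hδ x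

/-- **THE LOCAL KOTTWITZ SIGNS ARE PRESERVED BY MATRIX-CONJUGATION IDENTIFICATIONS** (`L` CM, `H, H′ ∈ M₃(L)` hermitian with
`det ≠ 0`, `v` a finite place of `L⁺`): if `ψ : U(H)(L⁺_v) → U(H′)(L⁺_v)` is surjective and `ψ g = S⁻¹ g S` for one
`S ∈ GL₃(L ⊗ L⁺_v)` — the engine's family pin (vii-c) — then `e_v(⟦ψ x⟧) = e_v(⟦x⟧)` for every `x`. Split `v`: both sides are `1`
(★ `kottwitzSignLocal_eq_one_of_smul_ne`); non-split `v`: `L ⊗ L⁺_v` is a field and ★ `kottwitzSign_conj_eq_of_forall_mem_iff` (the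
unipotent criterion is intrinsic to the abstract group). [cite: Rogawski1990, §4.1 (4.1.2) pp. 39–40; §14.2 p. 232] [cite: Kottwitz1983, §1] -/
theorem kottwitzSignLocal_mk_eq_of_forall_coe_eq_conj {H H' : Matrix (Fin 3) (Fin 3) L}
    (hH : (H.map (cmConjRingHom L))ᵀ = H) (hHd : H.det ≠ 0) (hH' : (H'.map (cmConjRingHom L))ᵀ = H') (hH'd : H'.det ≠ 0)
    (v : HeightOneSpectrum (𝓞 ↥(maximalRealSubfield L)))
    (ψ : (UnitaryGroup.cmDatum L 3 H).Local v → (UnitaryGroup.cmDatum L 3 H').Local v) (hψs : Function.Surjective ψ)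
    (S : GL (Fin 3) (UnitaryGroup.LocalRing L v))
    (hψ : ∀ g : (UnitaryGroup.cmDatum L 3 H).Local v,
      ((ψ g).val : GL (Fin 3) (UnitaryGroup.LocalRing L v)) = S⁻¹ * (g.val : GL (Fin 3) (UnitaryGroup.LocalRing L v)) * S)
    (x : (UnitaryGroup.cmDatum L 3 H).Local v) :
    kottwitzSignLocal L 3 H' v (ConjClasses.mk (ψ x)) = kottwitzSignLocal L 3 H v (ConjClasses.mk x) := by
  haveI : Algebra.IsQuadraticExtension ↥(maximalRealSubfield L) L := IsCMField.isQuadraticExtension L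
  obtain ⟨w⟩ := (inferInstance : Nonempty (UnitaryGroup.PlacesOver L v))
  by_cases hw : IsCMField.complexConj L • w.1 = w.1
  · -- NON-SPLIT place: `L ⊗ L⁺_v` is a field in place
    letI : Field (UnitaryGroup.LocalRing L v) :=
      (UnitaryGroup.LocalRing.isField_of_smul_eq (IsCMField.complexConj L) (IsCMField.complexConj_ne_one L) w hw).toField
    -- the letters of the criterion
    set σ : UnitaryGroup.LocalRing L v →+* UnitaryGroup.LocalRing L v := UnitaryGroup.conjLocal L (IsCMField.complexConj L) v with hσdef
    set Hv : Matrix (Fin 3) (Fin 3) (UnitaryGroup.LocalRing L v) :=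
      (UnitaryGroup.adelicForm L 3 H).map (UnitaryGroup.adeleToLocal L v) with hHvdef
    set H'v : Matrix (Fin 3) (Fin 3) (UnitaryGroup.LocalRing L v) :=
      (UnitaryGroup.adelicForm L 3 H').map (UnitaryGroup.adeleToLocal L v) with hH'vdef
    have hσσ : ∀ y, σ (σ y) = y := conjLocal_conjLocal L v
    have hσ1 : ∃ y, σ y ≠ y := exists_conjLocal_ne L v
    have hHv : (Hv.map σ)ᵀ = Hv := UnitaryGroup.map_conjLocal_transpose_localForm L 3 H v hH
    have hH'v : (H'v.map σ)ᵀ = H'v := UnitaryGroup.map_conjLocal_transpose_localForm L 3 H' v hH'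
    have hdetv : Hv.det ≠ 0 := (UnitaryGroup.isUnit_det_localForm L 3 H v hHd).ne_zero
    have hdet'v : H'v.det ≠ 0 := (UnitaryGroup.isUnit_det_localForm L 3 H' v hH'd).ne_zero
    -- the two spellings of «unitary group» have the same membership text
    have hmem : ∀ g : GL (Fin 3) (UnitaryGroup.LocalRing L v),
        g ∈ unitaryGroup σ Hv ↔ g ∈ UnitaryGroup.«local» L (IsCMField.complexConj L) 3 H v := fun g => Iff.rfl
    have hmem' : ∀ g : GL (Fin 3) (UnitaryGroup.LocalRing L v),
        g ∈ unitaryGroup σ H'v ↔ g ∈ UnitaryGroup.«local» L (IsCMField.complexConj L) 3 H' v := fun g => Iff.rfl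
    -- `ψ` conjugates `U(H)_v` onto `U(H′)_v`
    have hS : ∀ g : GL (Fin 3) (UnitaryGroup.LocalRing L v), g ∈ unitaryGroup σ Hv ↔ S⁻¹ * g * S ∈ unitaryGroup σ H'v := by
      intro g
      constructor
      · intro hg
        rw [hmem', ← hψ ⟨g, (hmem g).1 hg⟩]
        exact (ψ ⟨g, (hmem g).1 hg⟩).2
      · intro hg
        obtain ⟨y, hy⟩ := hψs ⟨S⁻¹ * g * S, (hmem' _).1 hg⟩
        have hyv : S⁻¹ * (y.val : GL (Fin 3) (UnitaryGroup.LocalRing L v)) * S = S⁻¹ * g * S := by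
          rw [← hψ y, hy]
        have hyg : (y.val : GL (Fin 3) (UnitaryGroup.LocalRing L v)) = g := by
          have := congrArg (fun z => S * z * S⁻¹) hyv
          simpa [mul_assoc] using this
        rw [hmem, ← hyg]
        exact y.2
    -- apply the conjugation invariance of the unipotent criterion
    let γ : unitaryGroup σ Hv := ⟨x.val, (hmem _).2 x.2⟩
    have hγ : ((γ : GL (Fin 3) (UnitaryGroup.LocalRing L v)) : Matrix (Fin 3) (Fin 3) (UnitaryGroup.LocalRing L v)) =
        ((x.val : GL (Fin 3) (UnitaryGroup.LocalRing L v)).val : Matrix (Fin 3) (Fin 3) (UnitaryGroup.LocalRing L v)) := rfl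
    rw [kottwitzSignLocal_mk, kottwitzSignLocal_mk, hψ x]
    have key := kottwitzSign_conj_eq_of_forall_mem_iff hσσ hσ1 hHv hdetv hH'v hdet'v S hS γ
    rw [hγ] at key
    rw [← key, Units.val_mul, Units.val_mul]
  · -- SPLIT place: both sides are `1`
    rw [kottwitzSignLocal_eq_one_of_smul_ne L 3 H' v w hw, kottwitzSignLocal_eq_one_of_smul_ne L 3 H v w hw]

end CM

end Literature.NumberTheory.Rogawski1990
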